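import Summits.BirchSwinnertonDyer.Rank1Residual.X11b.CertificateRecordsGeneric
import Summits.BirchSwinnertonDyer.Rank1Residual.X11b.RegMultCertificateJoin
import HarnessLib

/-!
# REG-MULT certificates on x11c's RECORD pipeline: `fullCheck r = true` + analytic rank one + ONE
# regulator row ⟹ `BSD(E,p)` for the record's curve — no `L`-side computation (census cell
# `bsd-formula-census`, seat conjecture-typer 2, CELL-PLAN §3 H-7 "per-pair instances")

HONEST FRAMING (run/shared/lean/b2b/bsd-rank1-residual/, verbatim in every file): the goal of the
cell is to DELETE the COMBINATION-SHAPED residual classes of the Birch–Swinnerton-Dyer formula for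
ALL analytic-rank `≤ 1` elliptic curves over `ℚ` — "full BSD formula for every rank `≤ 1` curve in
class `C`" assembled STRICTLY from published theorems — so that the rank-`≤ 1` remainder becomes
exactly the CONSTRUCTION-SHAPED classes, which are TYPED (missing-input `Prop`s), NOT attempted.
This is not "finishing BSD". Research route; no claim beyond the stated classes; census / instrument
output = EVIDENCE / certificate rows, never a Literature fact; a REG-MULT row is a per-pair COMPUTED
INPUT (instrumentation tier; booking = referee A / director); Schneider's conjecture is never asserted
class-wide. Nothing below is booked; X11b (N8/O2) stays CONSTRUCTION-SHAPED; everything is PER RECORD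
and CONDITIONAL on the named published facts in the binders and on the record's two claimed numbers.

## What this file adds to `CertificateRecordsGeneric` (x11c gen 9, `bsdp_of_fullCheck`)

There, a beyond-window record `r : X11RankOneCertificates.Record` with `fullCheck r = true` (kernel
`decide`: bad-prime support, Kraus/Silverman minimality, `p ≥ 5` prime, `p ∣ Δ ∧ p ∤ c₄`, split bit,
(ram) witness, Mazur irreducibility witness, `p ∤ #Ш_an`) plus THREE engine numbers — analytic rank
`1`, `#Ш_an` as recorded, and the two-engine `p`-ADIC BSD VALUATION certificate `r.CertSplit` /
`r.CertNonsplit` (order of vanishing AND leading-term valuation of THE Mazur–Tate–Teitelbaum function: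
modular symbols at level `N`, memory-bound beyond `N ≈ 2·10⁴`) — gives `BSD(E,p)`.

Here the `p`-adic `L`-side is taken FROM PRINT instead of from computation: Disegni 2020 Thm. 1
(`thm1_padicBSD_rankOne_multiplicative`, `hD`; with Skinner 2016 Thm. A, Stein–Wuthrich 2013 Thm. 6.1
and §4.2 height existence, GZK, modularity — the lever `ClassClosure.bsdp_of_leverLocus_of_
regulatorNonvanishing`, p249673), so the record needs only TWO numbers: analytic rank `1` and ONE
REG-MULT row — `RegMult.CertNonsplit r.curve r.p P m` if non-split, `RegMult.CertSplit r.curve r.p P m`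
if split (the Stein–Wuthrich §4.2 height of an admissible multiple `m·P` of a rational point is
non-zero; seconds per pair at any conductor, two engines: W5 `REGMULT-STEP0.md` PASS 966/966).
`RegMult.bsdp_of_fullCheck_of_cert` / `…_of_cert'` (instance-free form) / `RegMult.bsdp_of_all_
fullCheck_of_cert` (batch form, one `decide` per batch file as in x11c's pipeline). The `p ∤ #Ш_an`
clause of `redCheck` is inherited (the lever itself allows any `#Ш_an`); on the 3 723 (ram) cells of
N8 at `p ≥ 5` it holds on every cell (`class-closure/N8/pairs.tsv`, column `ord_p_sha = 0`
throughout). Nothing is evaluated here: record files (`decide` batches) are the instance owners'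
(x11c lineage / cc-typer-3 / this seat's successor) once W5's production rows exist.
[cite: Disegni2020, Thm. 1 (§1.2)] [cite: Skinner2016PacificMC, Thm. A] [cite: SteinWuthrich2013, Thm. 6.1, §4.2]
[cite: Mazur1978, §6 Prop. 6.3 (1) (p. 153)] [cite: SilvermanAEC2009, VII.5 Prop. 5.1]
-/

noncomputable section

open scoped Classical MatrixGroups ModularForm

open CongruenceSubgroup WeierstrassCurve Literature.NumberTheory.EllipticCurves
  Literature.NumberTheory.EllipticCurves.ModularForms
  Literature.NumberTheory.EllipticCurves.Rank1Residual
  Literature.NumberTheory.EllipticCurves.Rank1Residual.Typed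
  Literature.NumberTheory.EllipticCurves.Rank1Residual.X11RankOneCertificates
  Literature.NumberTheory.EllipticCurves.Skinner2016
  Literature.NumberTheory.EllipticCurves.SteinWuthrich2013
  Literature.NumberTheory.EllipticCurves.Disegni2020

namespace Summit.BirchSwinnertonDyer.Rank1Residual.X11b

namespace RegMult

variable (r : Record)

/-- **A record passing `fullCheck`, analytic rank one, ONE REG-MULT row ⟹ `BSD(E,p)`.** From the
check: `Mult`, the split type named by `r.split`, `Ram`, `Irr`, `p ≥ 5` (`reduction_of_checks`,
`prime_of_redCheck`); hence `ClassX11b` and the lever locus; the row matching the split bit discharges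
the Schneider half (`RegMult.bsdp_of_leverLocus_of_cert`). Published inputs: Skinner 2016 Thm. A `hA`,
SW 2013 Thm. 6.1 `hJn hJs`, SW §4.2 existence `hHn hHs`, Disegni 2020 Thm. 1 `hD`, GZK `hGZK`,
modularity `hpar`. Per record; CONDITIONAL; nothing booked. [cite: Disegni2020, Thm. 1 (§1.2)]
[cite: Skinner2016PacificMC, Thm. A] [cite: SteinWuthrich2013, Thm. 6.1, §4.2] -/
theorem bsdp_of_fullCheck_of_cert (hc : fullCheck r = true)
    [Fact r.p.Prime] [r.curve.IsElliptic] [r.curve.IsGloballyMinimal]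
    (hA : thmA_charIdeal_multiplicative)
    (hJn : thm61_nonsplitMultiplicative) (hJs : thm61_splitMultiplicative)
    (hHn : exists_isMultCanonical) (hHs : exists_isSplitMultCanonical)
    (hD : thm1_padicBSD_rankOne_multiplicative)
    (hGZK : rank_eq_analyticRank_of_analyticRank_le_one) (hpar : nonempty_modularParametrizationData)
    (hran : r.curve.analyticRank = 1) {P : r.curve.toAffine.Point} {m : ℕ}
    (hcn : r.split = false → CertNonsplit r.curve r.p P m)
    (hcs : r.split = true → CertSplit r.curve r.p P m) : BSDp r.curve r.p := by
  obtain ⟨hs, -, hred, hirr⟩ := (fullCheck_iff r).mp hc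
  obtain ⟨hmult, hsp, hnsp, hram, hirr'⟩ := reduction_of_checks r hs hred hirr
  have hp5 : 5 ≤ r.p := (prime_of_redCheck r hred).2.1
  have hX : ClassX11b r.curve r.p := ⟨hran, by omega, hmult, hirr'⟩
  refine bsdp_of_leverLocus_of_cert r.curve r.p hA hJn hJs hHn hHs hD hGZK hpar hX ⟨hram, fun _ => hp5⟩
    (P := P) (m := m) ?_ ?_
  · intro hns
    cases hb : r.split
    · exact hcn hb
    · exact absurd (hsp hb) hns
  · intro hsplit
    cases hb : r.split
    · exact absurd hsplit (hnsp hb)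
    · exact hcs hb

/-- **Instance-free form** (the three instances are consequences of the check, `instances_of_fullCheck`):
the record's two claimed numbers — analytic rank `1` and a REG-MULT row `(P, m)` matching its split
bit — under the binder `hnum`. [cite: Disegni2020, Thm. 1 (§1.2)] [cite: Skinner2016PacificMC, Thm. A]
[cite: SteinWuthrich2013, Thm. 6.1, §4.2] -/
theorem bsdp_of_fullCheck_of_cert' (hc : fullCheck r = true)
    (hA : thmA_charIdeal_multiplicative)
    (hJn : thm61_nonsplitMultiplicative) (hJs : thm61_splitMultiplicative)
    (hHn : exists_isMultCanonical) (hHs : exists_isSplitMultCanonical)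
    (hD : thm1_padicBSD_rankOne_multiplicative)
    (hGZK : rank_eq_analyticRank_of_analyticRank_le_one) (hpar : nonempty_modularParametrizationData)
    (hnum : ∀ [Fact r.p.Prime] [r.curve.IsElliptic] [r.curve.IsGloballyMinimal],
      r.curve.analyticRank = 1 ∧ ∃ (P : r.curve.toAffine.Point) (m : ℕ),
        (r.split = false → CertNonsplit r.curve r.p P m) ∧ (r.split = true → CertSplit r.curve r.p P m)) :
    ∀ [Fact r.p.Prime] [r.curve.IsElliptic] [r.curve.IsGloballyMinimal], BSDp r.curve r.p := by
  intro _ _ _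
  obtain ⟨hran, P, m, hcn, hcs⟩ := hnum
  exact bsdp_of_fullCheck_of_cert r hc hA hJn hJs hHn hHs hD hGZK hpar hran hcn hcs

/-- **Batch form**: for a list `rs` with `rs.all fullCheck = true` (one `decide` per batch file),
every listed record's curve satisfies `BSD(E,p)` given the published facts, its analytic rank `1` and
its REG-MULT row — with NO instance hypothesis and NO `p`-adic `L`-value computed. Per record;
CONDITIONAL; nothing booked. [cite: Disegni2020, Thm. 1 (§1.2)] [cite: Skinner2016PacificMC, Thm. A]
[cite: SteinWuthrich2013, Thm. 6.1, §4.2] -/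
theorem bsdp_of_all_fullCheck_of_cert {rs : List Record} (hall : rs.all fullCheck = true)
    (hA : thmA_charIdeal_multiplicative)
    (hJn : thm61_nonsplitMultiplicative) (hJs : thm61_splitMultiplicative)
    (hHn : exists_isMultCanonical) (hHs : exists_isSplitMultCanonical)
    (hD : thm1_padicBSD_rankOne_multiplicative)
    (hGZK : rank_eq_analyticRank_of_analyticRank_le_one) (hpar : nonempty_modularParametrizationData)
    (hnum : ∀ r ∈ rs, ∀ [Fact r.p.Prime] [r.curve.IsElliptic] [r.curve.IsGloballyMinimal],
      r.curve.analyticRank = 1 ∧ ∃ (P : r.curve.toAffine.Point) (m : ℕ),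
        (r.split = false → CertNonsplit r.curve r.p P m) ∧ (r.split = true → CertSplit r.curve r.p P m))
    (r : Record) (hr : r ∈ rs) :
    ∃ (_ : Fact r.p.Prime) (_ : r.curve.IsElliptic) (_ : r.curve.IsGloballyMinimal),
      BSDp r.curve r.p := by
  have hc : fullCheck r = true := List.all_eq_true.mp hall r hr
  obtain ⟨hp, hE, hM⟩ := instances_of_fullCheck r hc
  haveI : Fact r.p.Prime := ⟨hp⟩
  haveI := hE
  haveI := hM
  exact ⟨inferInstance, hE, hM,
    bsdp_of_fullCheck_of_cert' r hc hA hJn hJs hHn hHs hD hGZK hpar (hnum r hr)⟩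

end RegMult

end Summit.BirchSwinnertonDyer.Rank1Residual.X11b
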